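import Summits.AtomisticToContinuum.HydrodynamicLimit.Theses.MourreKoopmanCharges
import Summits.AtomisticToContinuum.HydrodynamicLimit.Theorems.OneFlightGossipEngineEquilibriumStressVarianceDecayCorrDecay
import Summits.AtomisticToContinuum.HydrodynamicLimit.Theorems.InformationPercolationEngineChaosClosesEulerMaxwellianMoments
import Summits.AtomisticToContinuum.HydrodynamicLimit.Theorems.AntiMazurCoboundariesExponentialCertificate
import Summits.AtomisticToContinuum.HydrodynamicLimit.Theorems.MourreKoopmanChargesStressStrongMixingStressFramework
import HarnessLib

/-!
# Preparations for the kinetic shear-stress linear rung `OneBodyCompleteness → EquilibriumStressVarianceDecay`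
# of the crux `LinearToEntropyInBand` (stmt-AtomisticToContinuum-17740), route `MourreKoopmanCharges`

Support file 1/2 (`--supports stmt-AtomisticToContinuum-17740`; registered bookkeeping stub
`stub_shearGermAdmissible`) of the line `registered`, skeleton v4 (lead prover-line-…-17740-c3-0); the rung itself is
`Theorems/MourreKoopmanChargesLinearToEntropyInBandStressRung.lean`.

* § 1 two real-variable lemmas: the triangle Fubini identity `∫₀^τ (τ − s) K(s) ds = ∫₀^τ (∫₀^u K) du` for a
  bounded measurable `K`, and **Fejér from Cesàro, uniformly in a parameter** (`fejer_le_of_cesaro`): if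
  `|K_N| ≤ B` and `∀ δ ∃ S₀ ∀ S ≥ S₀ ∃ N₀ ∀ N ≥ N₀, |S⁻¹∫₀^S K_N| ≤ δ` (the Cesàro form of the typed crux
  `MourreKoopmanCharges.OneBodyCompleteness`, stmt-9583), then
  `∀ ε ∃ T₀ ∀ τ ≥ T₀ ∃ N₀ ∀ N ≥ N₀, 2τ⁻² ∫₀^τ (τ − s) K_N(s) ds ≤ ε` (the Fejér = Green–Kubo form of the window
  variance); the `N`-uniformity over `u ∈ [S₀ + 1, τ]` uses the hypothesis at the finitely many INTEGER anchors
  `j ≤ τ` only (`|∫₀^u K_N| ≤ |∫₀^{⌊u⌋} K_N| + B`);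
* § 2 the shear germ `v ↦ v⁰v¹` is an ADMISSIBLE `h` for `OneBodyCompleteness`: continuous, `|h v| ≤ 1·(1+‖v‖)²`
  (`MourreKoopmanChargesStressStrongMixing.abs_shearStress_le`), and
  Maxwellian-orthogonal to `1, vᵢ, |v|²` in the exact form of the crux's hypotheses (oddness under the coordinate
  reflections `reflB 0`, `reflB 1`; `stub_shearGermAdmissible`).

References: H. Spohn, *Large Scale Dynamics of Interacting Particles* (1991), Part I §7.1, Part II §1.7.
-/

noncomputable section

namespace Summit.AtomisticToContinuum.HydrodynamicLimit.Theorems.LTEInBand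

open MeasureTheory ProbabilityTheory Filter Topology Set
open Literature.Analysis.FluidPDE Literature.MathematicalPhysics.KineticTheory
open scoped InnerProductSpace ENNReal Interval
open Summit.AtomisticToContinuum.HydrodynamicLimit.Theorems
open BoltzmannGreenKuboOrthMomentum BoltzmannGreenKuboForallN EquilibriumStressVarianceDecayC3
open Summit.AtomisticToContinuum.HydrodynamicLimit.Theses

/-! ## § 1 Fejér means from Cesàro means, uniformly in a parameter -/

section RealVariable

/-- `|∫ₐᵇ f| ≤ B (b − a)` for `|f| ≤ B` and `a ≤ b`. [folklore] -/
theorem abs_intervalIntegral_le_of_abs_le {f : ℝ → ℝ} {B : ℝ} (hB : ∀ s, |f s| ≤ B) {a b : ℝ}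
    (hab : a ≤ b) : |∫ s in a..b, f s| ≤ B * (b - a) := by
  have h := intervalIntegral.norm_integral_le_of_norm_le_const (a := a) (b := b) (f := f) (C := B)
    (fun s _ => (Real.norm_eq_abs _).le.trans (hB s))
  rwa [Real.norm_eq_abs, abs_of_nonneg (sub_nonneg.2 hab)] at h

/-- `Iic u ∩ Ioc 0 τ = Ioc 0 u` for `u ≤ τ`. [folklore] -/
theorem Iic_inter_Ioc_eq {u τ : ℝ} (hu : u ≤ τ) : Iic u ∩ Ioc (0 : ℝ) τ = Ioc 0 u := by
  ext x
  simp only [mem_inter_iff, mem_Iic, mem_Ioc]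
  constructor
  · rintro ⟨h1, h2, -⟩
    exact ⟨h2, h1⟩
  · rintro ⟨h1, h2⟩
    exact ⟨h2, h1, h2.trans hu⟩

/-- `Ici s ∩ Ioc 0 τ = Icc s τ` for `0 < s`. [folklore] -/
theorem Ici_inter_Ioc_eq {s τ : ℝ} (hs : 0 < s) : Ici s ∩ Ioc (0 : ℝ) τ = Icc s τ := by
  ext x
  simp only [mem_inter_iff, mem_Ici, mem_Ioc, mem_Icc]
  constructor
  · rintro ⟨h1, -, h3⟩
    exact ⟨h1, h3⟩
  · rintro ⟨h1, h2⟩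
    exact ⟨h1, hs.trans_le h1, h2⟩

/-- **Triangle Fubini**: `∫₀^τ (τ − s) K(s) ds = ∫₀^τ (∫₀^u K(s) ds) du` for a bounded measurable `K` and
`0 ≤ τ` (both sides are the integral of `𝟙{s ≤ u} K(s)` over the square `(0,τ]²`). [folklore] -/
theorem integral_sub_mul_eq_integral_integral {K : ℝ → ℝ} (hK : Measurable K) {B : ℝ} (hB : ∀ s, |K s| ≤ B)
    {τ : ℝ} (hτ : 0 ≤ τ) :
    ∫ s in (0 : ℝ)..τ, (τ - s) * K s = ∫ u in (0 : ℝ)..τ, ∫ s in (0 : ℝ)..u, K s := by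
  haveI : IsFiniteMeasure (volume.restrict (Ioc (0 : ℝ) τ)) := ⟨by simp [Real.volume_Ioc]⟩
  set μ : Measure ℝ := volume.restrict (Ioc (0 : ℝ) τ) with hμ
  -- the kernel on the square
  set g : ℝ → ℝ → ℝ := fun u s => (Iic u).indicator K s with hg
  have hgm : Measurable (Function.uncurry g) := by
    have : Function.uncurry g = fun p : ℝ × ℝ => ({p : ℝ × ℝ | p.2 ≤ p.1}).indicator (fun p => K p.2) p := by
      funext p
      simp only [Function.uncurry, hg, Set.indicator_apply, Set.mem_Iic, Set.mem_setOf_eq]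
    rw [this]
    exact (hK.comp measurable_snd).indicator (measurableSet_le measurable_snd measurable_fst)
  have hgB : ∀ u s, |g u s| ≤ |B| := by
    intro u s
    simp only [hg, Set.indicator_apply]
    split_ifs
    · exact (hB s).trans (le_abs_self B)
    · rw [abs_zero]; exact abs_nonneg B
  have hint : Integrable (Function.uncurry g) (μ.prod μ) := by
    refine (integrable_const |B|).mono' hgm.aestronglyMeasurable (Eventually.of_forall fun p => ?_)
    rw [Real.norm_eq_abs]
    exact hgB p.1 p.2
  -- inner integral in `s`: `∫ g u s dμ(s) = ∫₀^u K` for `u ∈ (0, τ]`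
  have hinner : ∀ u ∈ Ioc (0 : ℝ) τ, ∫ s, g u s ∂μ = ∫ s in (0 : ℝ)..u, K s := by
    intro u hu
    rw [hμ, hg, integral_indicator measurableSet_Iic, Measure.restrict_restrict measurableSet_Iic,
      intervalIntegral.integral_of_le hu.1.le, Iic_inter_Ioc_eq hu.2]
  -- inner integral in `u`: `∫ g u s dμ(u) = (τ - s) K s` for `s ∈ (0, τ]`
  have hinner' : ∀ s ∈ Ioc (0 : ℝ) τ, ∫ u, g u s ∂μ = (τ - s) * K s := by
    intro s hs
    have e : (fun u => g u s) = fun u => (Ici s).indicator (fun _ => K s) u := by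
      funext u
      simp only [hg, Set.indicator_apply, Set.mem_Iic, Set.mem_Ici]
    rw [e, hμ, integral_indicator measurableSet_Ici, Measure.restrict_restrict measurableSet_Ici,
      Ici_inter_Ioc_eq hs.1, setIntegral_const, smul_eq_mul, measureReal_def, Real.volume_Icc,
      ENNReal.toReal_ofReal (sub_nonneg.2 hs.2)]
  -- assemble
  calc ∫ s in (0 : ℝ)..τ, (τ - s) * K s
      = ∫ s in Ioc (0 : ℝ) τ, (τ - s) * K s := intervalIntegral.integral_of_le hτ
    _ = ∫ s, ∫ u, g u s ∂μ ∂μ := by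
        rw [hμ]
        exact (setIntegral_congr_fun measurableSet_Ioc fun s hs => (hinner' s hs)).symm
    _ = ∫ u, ∫ s, g u s ∂μ ∂μ := (integral_integral_swap hint).symm
    _ = ∫ u in Ioc (0 : ℝ) τ, ∫ s in (0 : ℝ)..u, K s := by
        rw [hμ]
        exact setIntegral_congr_fun measurableSet_Ioc fun u hu => hinner u hu
    _ = ∫ u in (0 : ℝ)..τ, ∫ s in (0 : ℝ)..u, K s := (intervalIntegral.integral_of_le hτ).symm

/-- **Fejér from Cesàro, uniformly in a parameter.** Let `K_N : ℝ → ℝ` be measurable with `|K_N| ≤ B`, and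
suppose the Cesàro means are eventually small, first in the window then in the parameter:
`∀ δ > 0 ∃ S₀ > 0 ∀ S ≥ S₀ ∃ N₀ ∀ N ≥ N₀, |S⁻¹ ∫₀^S K_N| ≤ δ`. Then so are the Fejér means:
`∀ ε > 0 ∃ T₀ > 0 ∀ τ ≥ T₀ ∃ N₀ ∀ N ≥ N₀, 2τ⁻² ∫₀^τ (τ − s) K_N(s) ds ≤ ε`. The parameter threshold for the
window `τ` is the maximum of the Cesàro thresholds at the INTEGER anchors `j ≤ τ`: for `u ∈ [S₀ + 1, τ]`,
`|∫₀^u K_N| ≤ |∫₀^{⌊u⌋} K_N| + B ≤ τδ + B`. [folklore] -/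
theorem fejer_le_of_cesaro {K : ℕ → ℝ → ℝ} (hKm : ∀ N, Measurable (K N)) {B : ℝ} (hB0 : 0 ≤ B)
    (hB : ∀ N s, |K N s| ≤ B)
    (hces : ∀ δ : ℝ, 0 < δ → ∃ S₀ : ℝ, 0 < S₀ ∧ ∀ S : ℝ, S₀ ≤ S → ∃ N₀ : ℕ, ∀ N : ℕ, N₀ ≤ N →
      |S⁻¹ * ∫ s in (0 : ℝ)..S, K N s| ≤ δ) :
    ∀ ε : ℝ, 0 < ε → ∃ T₀ : ℝ, 0 < T₀ ∧ ∀ τ : ℝ, T₀ ≤ τ → ∃ N₀ : ℕ, ∀ N : ℕ, N₀ ≤ N →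
      2 * τ⁻¹ ^ 2 * ∫ s in (0 : ℝ)..τ, (τ - s) * K N s ≤ ε := by
  intro ε hε
  obtain ⟨S₀, hS₀, hS⟩ := hces (ε / 4) (by positivity)
  choose! Nf hNf using hS
  set S₁ : ℝ := S₀ + 1 with hS₁
  have hS₁pos : 0 < S₁ := by rw [hS₁]; linarith
  set T₀ : ℝ := max S₁ (4 * B * (S₁ + 1) / ε) with hT₀
  refine ⟨T₀, lt_max_of_lt_left hS₁pos, fun τ hτ => ?_⟩
  have hτS₁ : S₁ ≤ τ := (le_max_left _ _).trans hτ
  have hτpos : 0 < τ := hS₁pos.trans_le hτS₁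
  have hτB : 4 * B * (S₁ + 1) / ε ≤ τ := (le_max_right _ _).trans hτ
  -- common parameter threshold: the max of the Cesàro thresholds at the integer anchors `j ≤ τ`
  refine ⟨(Finset.range (⌊τ⌋₊ + 1)).sup fun j => Nf j, fun N hN => ?_⟩
  have hNj : ∀ j : ℕ, (j : ℝ) ≤ τ → S₀ ≤ (j : ℝ) → |((j : ℝ))⁻¹ * ∫ s in (0 : ℝ)..j, K N s| ≤ ε / 4 := by
    intro j hjτ hjS
    refine hNf j hjS N ((Finset.le_sup (f := fun j : ℕ => Nf (j : ℝ)) ?_).trans hN)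
    exact Finset.mem_range.2 (Nat.lt_succ_of_le (Nat.le_floor hjτ))
  -- the primitive `I(u) = ∫₀^u K_N` is bounded by `τ ε/4 + B (S₁ + 1)` on `[0, τ]`
  set I : ℝ → ℝ := fun u => ∫ s in (0 : ℝ)..u, K N s with hI
  have hIbound : ∀ u ∈ Ι (0 : ℝ) τ, |I u| ≤ τ * (ε / 4) + B * (S₁ + 1) := by
    intro u hu
    rw [Set.uIoc_of_le hτpos.le] at hu
    have hu0 : 0 ≤ u := hu.1.le
    have hBS : 0 ≤ B * (S₁ + 1) := by positivity
    have hτε : 0 ≤ τ * (ε / 4) := by positivity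
    by_cases hcase : u < S₁
    · -- short windows: the crude bound `|I u| ≤ B u ≤ B S₁`
      have h1 : |I u| ≤ B * (u - 0) := abs_intervalIntegral_le_of_abs_le (hB N) hu0
      have h2 : B * (u - 0) ≤ B * (S₁ + 1) := by
        rw [sub_zero]; exact mul_le_mul_of_nonneg_left (by linarith) hB0
      linarith
    · -- long windows: anchor at `j = ⌊u⌋`
      push Not at hcase
      set j : ℕ := ⌊u⌋₊ with hj
      have hju : (j : ℝ) ≤ u := Nat.floor_le hu0
      have huj : u < (j : ℝ) + 1 := Nat.lt_floor_add_one u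
      have hjS : S₀ ≤ (j : ℝ) := by rw [hS₁] at hcase; linarith
      have hjpos : 0 < (j : ℝ) := hS₀.trans_le hjS
      have hjτ : (j : ℝ) ≤ τ := hju.trans hu.2
      have hanchor : |∫ s in (0 : ℝ)..j, K N s| ≤ τ * (ε / 4) := by
        have h := hNj j hjτ hjS
        rw [abs_mul, abs_inv, abs_of_pos hjpos, inv_mul_le_iff₀ hjpos] at h
        exact h.trans (mul_le_mul_of_nonneg_right hjτ (by positivity))
      have hsplit : I u = (∫ s in (0 : ℝ)..j, K N s) + ∫ s in (j : ℝ)..u, K N s := by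
        rw [hI]
        exact (intervalIntegral.integral_add_adjacent_intervals
          (AntiMazurCoboundariesExponentialCertificate.intervalIntegrable_of_bounded (hKm N) (hB N) _ _)
          (AntiMazurCoboundariesExponentialCertificate.intervalIntegrable_of_bounded (hKm N) (hB N) _ _)).symm
      have htail : |∫ s in (j : ℝ)..u, K N s| ≤ B := by
        have h := abs_intervalIntegral_le_of_abs_le (hB N) hju
        have : B * (u - j) ≤ B * 1 := mul_le_mul_of_nonneg_left (by linarith) hB0
        linarith
      calc |I u| ≤ |∫ s in (0 : ℝ)..j, K N s| + |∫ s in (j : ℝ)..u, K N s| := by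
            rw [hsplit]; exact abs_add_le _ _
        _ ≤ τ * (ε / 4) + B := add_le_add hanchor htail
        _ ≤ τ * (ε / 4) + B * (S₁ + 1) := by nlinarith
  -- integrate the bound and use the triangle Fubini identity
  have hFub := integral_sub_mul_eq_integral_integral (hKm N) (hB N) hτpos.le
  have hint : |∫ u in (0 : ℝ)..τ, I u| ≤ (τ * (ε / 4) + B * (S₁ + 1)) * (τ - 0) := by
    have h := intervalIntegral.norm_integral_le_of_norm_le_const (a := 0) (b := τ) (f := I)
      (C := τ * (ε / 4) + B * (S₁ + 1)) (fun u hu => by rw [Real.norm_eq_abs]; exact hIbound u hu)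
    rwa [Real.norm_eq_abs, abs_of_nonneg (sub_nonneg.2 hτpos.le)] at h
  rw [sub_zero] at hint
  have hmain : ∫ s in (0 : ℝ)..τ, (τ - s) * K N s ≤ (τ * (ε / 4) + B * (S₁ + 1)) * τ := by
    rw [hFub]; exact (le_abs_self _).trans hint
  have hτinv : 2 * τ⁻¹ ^ 2 * ((τ * (ε / 4) + B * (S₁ + 1)) * τ) = ε / 2 + 2 * (B * (S₁ + 1)) / τ := by
    field_simp
    ring
  have hsmall : 2 * (B * (S₁ + 1)) / τ ≤ ε / 2 := by
    rw [div_le_iff₀ hτpos]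
    have := (div_le_iff₀ hε).1 hτB
    nlinarith
  calc 2 * τ⁻¹ ^ 2 * ∫ s in (0 : ℝ)..τ, (τ - s) * K N s
      ≤ 2 * τ⁻¹ ^ 2 * ((τ * (ε / 4) + B * (S₁ + 1)) * τ) :=
        mul_le_mul_of_nonneg_left hmain (by positivity)
    _ = ε / 2 + 2 * (B * (S₁ + 1)) / τ := hτinv
    _ ≤ ε := by linarith

end RealVariable

/-! ## § 2 The data of `OneBodyCompleteness` for the kinetic shear stress -/


section ShearGerm

/-- `v⁰v¹ · vᵢ` is odd under `v¹ ↦ −v¹` for `i ≠ 1`. [folklore] -/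
theorem shearGerm_mul_coord_reflB_one (v : V3) {i : Fin 3} (hi : i ≠ 1) :
    (reflB 1 v) 0 * (reflB 1 v) 1 * (reflB 1 v) i = -(v 0 * v 1 * v i) := by
  simp [reflB_apply, hi]

/-- `v⁰v¹ · v¹` is odd under `v⁰ ↦ −v⁰`. [folklore] -/
theorem shearGerm_mul_coord_one_reflB_zero (v : V3) :
    (reflB 0 v) 0 * (reflB 0 v) 1 * (reflB 0 v) 1 = -(v 0 * v 1 * v 1) := by
  simp [reflB_apply]

/-- `v⁰v¹ · |v|²` is odd under `v⁰ ↦ −v⁰` (the reflection is an isometry). [folklore] -/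
theorem shearGerm_mul_norm_sq_reflB_zero (v : V3) :
    (reflB 0 v) 0 * (reflB 0 v) 1 * ‖reflB 0 v‖ ^ 2 = -(v 0 * v 1 * ‖v‖ ^ 2) := by
  rw [LinearIsometryEquiv.norm_map]
  simp [reflB_apply]

/-- Pairings with the Maxwellian `M_{1,θ,0}` of a function odd under a coordinate reflection vanish:
`∫ ψ M_{1,θ,0} dv = ∫ ψ dN(0, θ) = ∫ ψ(√θ w) dγ(w) = 0`. [folklore] -/
theorem integral_mul_localMaxwellian_eq_zero_of_odd {θ : ℝ} (hθ : 0 < θ) (k : Fin 3) {ψ : V3 → ℝ}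
    (hψ : ∀ v, ψ (reflB k v) = -ψ v) :
    ∫ v, ψ v * localMaxwellian 1 θ (0 : V3) v = 0 := by
  rw [← ChaosClosesEulerMaxwellianMoments.integral_gaussMeasure_eq_integral_mul_localMaxwellian hθ 0 ψ,
    integral_gaussMeasure 0 hθ]
  refine integral_stdGaussian_eq_zero_of_odd (reflB k) (G := fun w => ψ (0 + Real.sqrt θ • w)) fun w => ?_
  simp only [zero_add]
  rw [← LinearIsometryEquiv.map_smul]
  exact hψ _

/-- The shear germ is Maxwellian-orthogonal to `1` (hypothesis of `OneBodyCompleteness`). [folklore] -/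
theorem shearGerm_orth_one {θ : ℝ} (hθ : 0 < θ) :
    ∫ v, (fun v : V3 => v 0 * v 1) v * localMaxwellian 1 θ (0 : V3) v = 0 :=
  integral_mul_localMaxwellian_eq_zero_of_odd hθ 0 fun v => shear_reflB_zero v

/-- The shear germ is Maxwellian-orthogonal to each `vᵢ` (hypothesis of `OneBodyCompleteness`). [folklore] -/
theorem shearGerm_orth_coord {θ : ℝ} (hθ : 0 < θ) (i : Fin 3) :
    ∫ v, (fun v : V3 => v 0 * v 1) v * v i * localMaxwellian 1 θ (0 : V3) v = 0 := by
  by_cases hi : i = 1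
  · subst hi
    exact integral_mul_localMaxwellian_eq_zero_of_odd hθ 0 fun v => shearGerm_mul_coord_one_reflB_zero v
  · exact integral_mul_localMaxwellian_eq_zero_of_odd hθ 1 fun v => shearGerm_mul_coord_reflB_one v hi

/-- The shear germ is Maxwellian-orthogonal to `|v|²` (hypothesis of `OneBodyCompleteness`). [folklore] -/
theorem shearGerm_orth_norm_sq {θ : ℝ} (hθ : 0 < θ) :
    ∫ v, (fun v : V3 => v 0 * v 1) v * ‖v‖ ^ 2 * localMaxwellian 1 θ (0 : V3) v = 0 :=
  integral_mul_localMaxwellian_eq_zero_of_odd hθ 0 fun v => shearGerm_mul_norm_sq_reflB_zero v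

end ShearGerm

/-- **Registered bookkeeping stub `stub_shearGermAdmissible` (crux stmt-AtomisticToContinuum-17740): the shear germ
`v ↦ v⁰v¹` satisfies every hypothesis `OneBodyCompleteness` puts on the one-body field `h`** — continuity,
polynomial growth, and Maxwellian orthogonality to `1`, `vᵢ`, `|v|²` at every temperature. [folklore] -/
theorem stub_shearGermAdmissible : (Continuous fun v : Literature.MathematicalPhysics.KineticTheory.V3 => v 0 * v 1) ∧ (∃ (C : ℝ) (k : ℕ), ∀ v : Literature.MathematicalPhysics.KineticTheory.V3, |v 0 * v 1| ≤ C * (1 + ‖v‖) ^ k) ∧ (∀ θ : ℝ, 0 < θ → (∫ v, (fun v : Literature.MathematicalPhysics.KineticTheory.V3 => v 0 * v 1) v * Literature.Analysis.FluidPDE.localMaxwellian 1 θ (0 : Literature.MathematicalPhysics.KineticTheory.V3) v = 0) ∧ (∀ i : Fin 3, ∫ v, (fun v : Literature.MathematicalPhysics.KineticTheory.V3 => v 0 * v 1) v * v i * Literature.Analysis.FluidPDE.localMaxwellian 1 θ (0 : Literature.MathematicalPhysics.KineticTheory.V3) v = 0) ∧ (∫ v, (fun v : Literature.MathematicalPhysics.KineticTheory.V3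 => v 0 * v 1) v * ‖v‖ ^ 2 * Literature.Analysis.FluidPDE.localMaxwellian 1 θ (0 : Literature.MathematicalPhysics.KineticTheory.V3) v = 0)) :=
  ⟨by fun_prop, ⟨1, 2, MourreKoopmanChargesStressStrongMixing.abs_shearStress_le⟩, fun _ hθ =>
    ⟨shearGerm_orth_one hθ, shearGerm_orth_coord hθ, shearGerm_orth_norm_sq hθ⟩⟩

end Summit.AtomisticToContinuum.HydrodynamicLimit.Theorems.LTEInBand

end
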